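import Mathlib
import HarnessLib
import Summits.HubbardSuperconductivity.HubbardSuperconductivity.Theorems.KLProgrammeKLRegimeEnginePairTransferBaseScaleZero
import Summits.HubbardSuperconductivity.HubbardSuperconductivity.Theorems.KLProgrammeKLRegimeEnginePairTransferBaseCore
import Summits.HubbardSuperconductivity.HubbardSuperconductivity.Theorems.KLProgrammeKLRegimeEngineV8DefsU10
import Summits.HubbardSuperconductivity.HubbardSuperconductivity.Theorems.KLProgrammeKLRegimeEngineV8DefsL4

/-!
# Route `KLProgramme` — ENGINE item stmt-HubbardSuperconductivity-20437 `KLRegimeEngineV17F2`, row (X) conjunct (X).2′ (class #5 «95v2»): THE A PRIORI MEMBER ROWS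
# IN GRID CURRENCY — **`klmx_memberArray_zero_le`** (scale `0`: a THEOREM), **`klmx_memberArray_zero_le_klEng`** (the same under the engine's binders),
# **`klmx_memberArray_le_gridBinomial`** (scale `n`: ⇐ the pinned GRID kernel norms of the scale-`n` grid action + the member's soft mass)
# (cell gate-hubbard-kl, seat hubbard-kl-k3c1-p1 g23, technique «composed-map remainder propagation»: carrier `e^{Δ_D}𝒲^K_Λ = map S (e^{Δ_{SᵀDS}} Gg_Λ)`)

WHY.  The class-#5 one-call «95v2» (`exists_isTransferPkg8_of_analytic_resolved_sized_klTS_pinned2_unguarded`, ✓ p698479; read BY TYPE in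
`EngineV8.A24a1G14.stub_engine_exports_of_class5Rows(Cap)`, ✓ p729777) carries three A PRIORI MEMBER ROWS of «class #1» type — `hbase`'s two rows
`‖𝒜₀[s_{0,j}](Q;x,y)‖ ≤ mA U`, `‖𝒜₀[s_{0,j′}](Q;x,y)‖ ≤ mA U` at scale `0` and `hexport`'s `‖𝒜ₙ[s_{n,j′}](Q;x,y)‖ ≤ mA U` at every scale `n ≤ j′` — where
`𝒜ₙ[ψ] = klMemberArrayF … n ψ` is (on the bare ball) the quartic vertex of the SMEARED action `e^{Δ_{S_ψ}}𝒲^{Kₙ}_{Λₙ}` at the pair labels.  They are the only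
rows of (X).2′ whose object is not already in the GRID currency of the other kernel rows (`Ng(m′)` = pinned grid kernel norms of `Gg(Λ) = effAction (SᵀC^K_{>Λ}S)(V_N + 𝒩_{K,N})`).
This file converts them:
* **`klmx_memberArray_zero_le`** — AT SCALE 0 THE ROW IS A THEOREM: for `R.WF`, `0 < U ≤ 1`, `FrameOK R U N μ K₀` (`K₀ = klFlowFrameU … 0`), `klBetaMin ≤ β ≤ L`, `β³ ≤ M`,
  `klScaleZeroThetaC R·U ≤ 1/4` and EVERY `j, Q, x, y`: `‖𝒜₀[s_{0,j}](Q;x,y)‖ ≤ U + (klScaleZeroValC R + klTransferC R)·U²` — triangle through the plain amplitude: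
  k3c2-p1 g5's scale-0 transfer `‖𝒱₄(e^{Δ_D}𝒱₀) − 𝒞₀‖ ≤ klTransferC R·U²` (`norm_klCovSmearedPairAmplitude_zero_sub_le_sq`, every admissible `D`; `S_{s_{0,j}}` is admissible by
  `isSoftSubCov_softCovOf ∘ isSoftSymbol_compl`) + p3's `‖𝒞₀ − U‖ ≤ klScaleZeroValC R·U²` (`norm_klPairAmplitude_zero_sub_le_sq`).
* **`klmx_memberArray_zero_le_klEng`** — the same under the ENGINE's binders (`R.WF2`, `0 < U ≤ klEngU₀10 P R cc`, `klBetaMin ≤ β`, `klEngL₄ P R β U ≤ L`, `klEngM₃ β U L ≤ M`,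
  `FrameOK … K₀`): the doors `U ≤ 1`, `θC·U ≤ 1/4`, `β ≤ L`, `β³ ≤ M` are read from `klEngU₀10 ≤ klEngU₀3`, `le_of_klEngL₄_le`, `pow_three_le_of_klEng` — so `hbase`'s two a priori
  rows hold as soon as `U + (klScaleZeroValC R + klTransferC R)·U² ≤ mA U` (ONE scalar door on the envelope `mA`).
* **`klmx_memberArray_le_gridBinomial`** — AT SCALE `n` THE ROW IS GRID CURRENCY: for `FrameOK R U N μ Kₙ`, `klBetaMin ≤ β ≤ L`, `n ≤ j′`, and pinned grid kernel norms
  `Σ_{Y : Y_i = w}‖kernel_{2m′}(Gg_n)(Y)‖ ≤ Ng(m′)` of the scale-`n` grid action `Gg_n = effAction (SᵀC^{Kₙ}_{>Λₙ}S)(V_N + 𝒩_{Kₙ,N})` (`S = hubbardGridSub … (4M)`):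
  `‖𝒜ₙ[s_{n,j′}](Q;x,y)‖ ≤ (4!/(βL²))·(#legs·Σ_{m′ ≥ 2} C(2m′,4)·(√(Λₙ·15367))^{2m′−4}·Ng(m′))` — `𝒲^{Kₙ}_{Λₙ} = map S Gg_n` (`klmg_carrier_eq_map_grid`), the member's
  soft mass `≤ 15367` (`klSoftMass_le_of_isSoftSymbol`) is a grid Gram constant `√(Λₙ·15367)` (`klmg_isGramBoundedR_gridSub_of_klSoftMass_le`), and the binomial–Gram value
  bound `klmg_vertexFn_map_gaussConv_le_binomial` (`p = 2`).  So `hexport` holds as soon as those grid norms are given with `(binomial number) ≤ mA U` — the SAME currency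
  as the successor rows' `M4/M6/M2` (`…GridSmearingMembers`).
Consumer: `EngineV8.A24a1G14.stub_engine_exports_of_class5RowsCapGrid` (companion file `…EngineV17F2ClosersXClass5Grid`).
Composition of landed theorems; nothing about the model's sizes is asserted; nothing asserts (X), any stub of 20437, K3, U₀, the window or superconductivity.  0 kit · 0 lit.
References: BGM 2006 §2.4 (2.36), §3 (3.2)–(3.8) [cite: BenfattoGiulianiMastropietro2006].
-/

noncomputable section

namespace Summit.HubbardSuperconductivity.HubbardSuperconductivity.Theorems.KLRegimeSplit

set_option linter.dupNamespace false -- summit = problem name (single-conjunct summit), D-0017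

open Real Finset Matrix Set Literature.MathematicalPhysics.QuantumLattice Literature.Probability.LatticeModels GrassmannAlgebra
open Summit.HubbardSuperconductivity.HubbardSuperconductivity.Theorems.KLProgrammeLegKernels
open Summit.HubbardSuperconductivity.HubbardSuperconductivity.Theorems.DispersionFlow
open Summit.HubbardSuperconductivity.HubbardSuperconductivity.Theorems.KLRegimeWick
open Summit.HubbardSuperconductivity.HubbardSuperconductivity.Theorems.EngineV8
open Summit.HubbardSuperconductivity.HubbardSuperconductivity.Theorems.ScaleZeroDecay

variable {L M : ℕ} [NeZero L] [NeZero M]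

/-! ## §1 Scale `0`: the a priori member row is a theorem -/

section ScaleZero

/-- **`klmx_memberArray_zero_le`** — at scale `0` every member array is `≤ U + (klScaleZeroValC R + klTransferC R)·U²` entrywise (zero off the bare ball; on it the
smeared quartic vertex, by the scale-0 transfer through the plain amplitude). -/
theorem klmx_memberArray_zero_le {R : RenConsts} (hR : R.WF) {U : ℝ} (hU : 0 < U) (hU1 : U ≤ 1)
    {Nsc : ℕ} {μ β : ℝ} (hK : FrameOK R U Nsc μ (klFlowFrameU L M β U μ 0)) (hβ : klBetaMin ≤ β) (hβL : β ≤ L)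
    (hβM : β ^ 3 ≤ (M : ℝ)) (hθ : klScaleZeroThetaC R * U ≤ 1 / 4) (j : ℕ) (Qm x y : TorusSite 2 L) :
    ‖klMemberArrayF L M β U μ 0 (softSymbolCompl L M β μ (klFlowFrameU L M β U μ 0) 0 j) Qm x y‖ ≤
      U + (klScaleZeroValC R + klTransferC R) * U ^ 2 := by
  have hG0 : 0 ≤ R.Gfr 0 := hR.2.2 0
  have hV := klScaleZeroValC_pos hG0
  have hT := klTransferC_pos hG0
  have hpos : 0 ≤ U + (klScaleZeroValC R + klTransferC R) * U ^ 2 := by positivity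
  by_cases hxy : x ∈ klBall L μ 0 ∧ y ∈ klBall L μ 0
  · rw [klMemberArrayF_apply_of_mem β U μ 0 _ Qm hxy.1 hxy.2]
    set K := klFlowFrameU L M β U μ 0 with hKdef
    have hθ2 : klScaleZeroThetaC R * U ≤ 1 / 2 := hθ.trans (by norm_num)
    have hD : IsSoftSubCov L M β μ K 0 (softCovOf L M β μ K (softSymbolCompl L M β μ K 0 j)) :=
      isSoftSubCov_softCovOf (isSoftSymbol_compl (L := L) (M := M) β μ K (Nat.zero_le j))
    have h1 := norm_klCovSmearedPairAmplitude_zero_sub_le_sq (L := L) (M := M) hR hU hU1 hK hβ hβL hβM hθ hD Qm x y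
    have h2 := norm_klPairAmplitude_zero_sub_le_sq (L := L) (M := M) hR hU hU1 hK hβ hβL hβM hθ2 Qm x y
    have hUn : ‖(U : ℂ)‖ = U := by rw [Complex.norm_real, Real.norm_eq_abs, abs_of_pos hU]
    set A := klCovSmearedPairAmplitude L M β U μ K 0 (softCovOf L M β μ K (softSymbolCompl L M β μ K 0 j)) Qm x y with hA
    set Pl := klPairAmplitude L M β U μ K 0 Qm x y with hPl
    have hsplit : A = (A - Pl) + (Pl - (U : ℂ)) + (U : ℂ) := by ring
    calc ‖A‖ = ‖(A - Pl) + (Pl - (U : ℂ)) + (U : ℂ)‖ := by rw [← hsplit]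
      _ ≤ ‖A - Pl‖ + ‖Pl - (U : ℂ)‖ + ‖(U : ℂ)‖ := norm_add₃_le
      _ ≤ klTransferC R * U ^ 2 + klScaleZeroValC R * U ^ 2 + U := by rw [hUn]; exact add_le_add (add_le_add h1 h2) le_rfl
      _ = U + (klScaleZeroValC R + klTransferC R) * U ^ 2 := by ring
  · rw [klMemberArrayF_eq_zero_off β U μ 0 _ Qm hxy, norm_zero]; exact hpos

/-- **`klmx_memberArray_zero_le_klEng`** — the same under the engine's binders: `R.WF2`, `0 < U ≤ klEngU₀10 P R cc`, `klBetaMin ≤ β`, `klEngL₄ P R β U ≤ L`,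
`klEngM₃ β U L ≤ M`, `FrameOK R U (nScales β) μ K₀` ⟹ `‖𝒜₀[s_{0,j}](Q;x,y)‖ ≤ U + (klScaleZeroValC R + klTransferC R)·U²`. -/
theorem klmx_memberArray_zero_le_klEng {P : SplitConsts} {R : RenConsts} (hR : R.WF2) {cc U : ℝ} (hU : 0 < U) (hU10 : U ≤ klEngU₀10 P R cc)
    {μ β : ℝ} (hβ : klBetaMin ≤ β) (hL : klEngL₄ P R β U ≤ L) (hM : klEngM₃ β U L ≤ M)
    (hK : FrameOK R U (nScales β) μ (klFlowFrameU L M β U μ 0)) (j : ℕ) (Qm x y : TorusSite 2 L) :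
    ‖klMemberArrayF L M β U μ 0 (softSymbolCompl L M β μ (klFlowFrameU L M β U μ 0) 0 j) Qm x y‖ ≤
      U + (klScaleZeroValC R + klTransferC R) * U ^ 2 := by
  have hU3 : U ≤ klEngU₀3 P R cc := hU10.trans (klEngU₀10_le_klEngU₀3 P R cc)
  exact klmx_memberArray_zero_le hR.wf hU (le_one_of_le_klEngU₀3 hU3) hK hβ (le_of_klEngL₄_le hL)
    (pow_three_le_of_klEng hβ (klEngL₃_le_of_klEngL₄_le hL) hM) (klScaleZeroThetaC_mul_le_quarter_of_le_klEngU₀3 hR.wf hU hU3) j Qm x y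

end ScaleZero

/-! ## §2 Scale `n`: the a priori member row from the pinned GRID kernel norms of the scale-`n` grid action -/

section ScaleN

/-- **`klmx_memberArray_le_gridBinomial`** — for an admissible flow frame `Kₙ`, `klBetaMin ≤ β ≤ L`, `n ≤ j′` and pinned grid kernel norms `Ng` of the scale-`n` grid
action `Gg_n = effAction (SᵀC^{Kₙ}_{>Λₙ}S)(V_N + 𝒩_{Kₙ,N})`:
`‖𝒜ₙ[s_{n,j′}](Q;x,y)‖ ≤ (4!/(βL²))·(#legs·Σ_{m′} [2 ≤ m′]·C(2m′,4)·(√(Λₙ·15367))^{2m′−4}·Ng(m′))`. -/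
theorem klmx_memberArray_le_gridBinomial {R : RenConsts} {U : ℝ} {Nsc : ℕ} {μ β : ℝ} {n : ℕ}
    (hK : FrameOK R U Nsc μ (klFlowFrameU L M β U μ n)) (hβ : klBetaMin ≤ β) (hβL : β ≤ L) {j' : ℕ} (hnj : n ≤ j')
    (Ng : ℕ → ℝ) (hN0 : ∀ m', 0 ≤ Ng m')
    (hN : ∀ m' (i : Fin (2 * m')) (w : GridLeg (GridPoint L (2 * (2 * M)))),
      ∑ Y ∈ univ.filter (fun Y : Fin (2 * m') → GridLeg (GridPoint L (2 * (2 * M))) => Y i = w),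
        ‖kernel ℂ (effAction ℂ ((hubbardGridSub L M β (2 * (2 * M))).transpose *
            hubbardCovAboveCT L M β μ 0 (klFlowFrameU L M β U μ n) (klScale klE0 n) * hubbardGridSub L M β (2 * (2 * M)))
          (hubbardGridInteraction L (2 * (2 * M)) β U + hubbardGridCounterQuadratic L (2 * (2 * M)) β (klFlowFrameU L M β U μ n))) (2 * m') Y‖ ≤ Ng m')
    (Qm x y : TorusSite 2 L) :
    ‖klMemberArrayF L M β U μ n (softSymbolCompl L M β μ (klFlowFrameU L M β U μ n) n j') Qm x y‖ ≤
      ((2 * 2).factorial : ℝ) / (β * (L : ℝ) ^ 2) * (Fintype.card (GridLeg (GridPoint L (2 * (2 * M)))) *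
        ∑ m' ∈ range (Fintype.card (GridLeg (GridPoint L (2 * (2 * M)))) / 2 + 1),
          if 2 ≤ m' then ((2 * m').choose (2 * 2) : ℝ) * Real.sqrt (klScale klE0 n * 15367) ^ (2 * m' - 2 * 2) * Ng m' else 0) := by
  set K := klFlowFrameU L M β U μ n with hKdef
  set ψ := softSymbolCompl L M β μ K n j' with hψ
  have hβ0 : 0 < β := lt_of_lt_of_le (by norm_num [klBetaMin]) hβ
  have hLpos : (0 : ℝ) < L := by exact_mod_cast Nat.pos_of_ne_zero (NeZero.ne L)
  have hγ : 0 ≤ Real.sqrt (klScale klE0 n * 15367) := Real.sqrt_nonneg _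
  have hGB := klmg_isGramBoundedR_gridSub_of_klSoftMass_le L M hβ0 μ K (2 * (2 * M)) n ψ (by norm_num : (0 : ℝ) ≤ 15367)
    (klSoftMass_le_of_isSoftSymbol hK hβ hβL (isSoftSymbol_compl (L := L) (M := M) β μ K hnj))
  have hRHS : 0 ≤ ((2 * 2).factorial : ℝ) / (β * (L : ℝ) ^ 2) * (Fintype.card (GridLeg (GridPoint L (2 * (2 * M)))) *
        ∑ m' ∈ range (Fintype.card (GridLeg (GridPoint L (2 * (2 * M)))) / 2 + 1),
          if 2 ≤ m' then ((2 * m').choose (2 * 2) : ℝ) * Real.sqrt (klScale klE0 n * 15367) ^ (2 * m' - 2 * 2) * Ng m' else 0) := by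
    refine mul_nonneg (div_nonneg (Nat.cast_nonneg _) (by positivity)) (mul_nonneg (Nat.cast_nonneg _) (sum_nonneg fun m' _ => ?_))
    split_ifs
    · exact mul_nonneg (mul_nonneg (Nat.cast_nonneg _) (pow_nonneg hγ _)) (hN0 m')
    · exact le_rfl
  by_cases hxy : x ∈ klBall L μ 0 ∧ y ∈ klBall L μ 0
  · rw [klMemberArrayF_apply_of_mem β U μ n ψ Qm hxy.1 hxy.2, klCovSmearedPairAmplitude, klEffectiveAction,
      klmg_carrier_eq_map_grid L M β U μ K hβ0.ne' _ (klScale klE0 n)]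
    exact klmg_vertexFn_map_gaussConv_le_binomial L M β hβ0 _ hγ hGB _ (klmg_gridAction_mem_evenPart L β U K _) Ng hN0 hN
      (p := 2) (by norm_num) _
  · rw [klMemberArrayF_eq_zero_off β U μ n ψ Qm hxy, norm_zero]; exact hRHS

end ScaleN

end Summit.HubbardSuperconductivity.HubbardSuperconductivity.Theorems.KLRegimeSplit

end
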